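import Literature.AnabelianGeometry.EtaleTheta.Discharge.Sec1Prop15iiiZLawOfGenerators
import HarnessLib

/-!
# [EtTh] Prop. 1.5 (iii) FORCES the shear `Ü ↦ q̈·Ü`: the `Z`-action clause implies
# `(σ₀·log Ü)² ≡ (log Ü · κ(q̈))² mod κ(O^×_K̈)`, so NO datum with deck-invariant `log(Ü)` satisfies it
# (a converse to `Sec1Prop15iiiZLawOfGenerators`; proof-only, at the `ThetaSetting` root)

S. Mochizuki, *The étale theta function and its Frobenioid-theoretic manifestations*, Publ. RIMS **45**
(2009) [EtTh], §1, Prop. 1.5 (iii), PRIMS PDF p. 23 (printed 249): "… on which `a ∈ Z` acts as follows: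
`η̈^Θ ↦ η̈^Θ − 2a·log(Ü) − (a²/2)·log(q_X) + log(O^×_K̈)`"; Prop. 1.4 (ii) p. 22: "`Θ̈(q_X^{a/2}·Ü) =
(−1)^a · q_X^{−a²/2} · Ü^{−2a} · Θ̈(Ü)`" [cite: MochizukiEtTh2009, Prop 1.5 (iii) p.23]. Layer L2 of the abc-iut cell,
seat abc-iut-L2-t12 (gen 5), ROW R184 «Prop 1.5 (iii) FACT → THEOREM», file D3.

THE POINT. In `Sec1Prop15iiiZLawOfGenerators` the display for all `σ` was DERIVED from the display at one
generator `σ₀` together with the `log(Ü)`-law `σ·log(Ü) = log(Ü)·κ(q̈)^{a}·κ(u)` (print: the deck generator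
sends `Ü ↦ q_X^{1/2}·Ü`). This file proves the CONVERSE constraint: the typed `Z`-action clause ALONE (for all
`σ`, as in `ThetaSetting.Prop15iii`) forces the `log(Ü)`-law up to squares — comparing the display at `σ₀²`
with the display at `σ₀` applied twice (`−4 = −2−2`, but `−4 ≠ −1−1−(cross term)` unless `σ₀` moves `log(Ü)`
by `κ(q̈)`):

* `ThetaSetting.KummerData.sq_conj_logUdd_of_zLaw` — from the display for `x′` at `σ₀` and at `σ₀·σ₀`
  (`toZ σ₀ = 1`), unit-class stability and `σ·κ(q̈) ∈ κ(q̈)κ(O^×)`: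
  **`(σ₀·log Ü)² = (log Ü)²·κ(q̈)²·κ(w)`** for a unit `w`;
* `ThetaSetting.EtaleThetaData.sq_conj_logUdd_of_prop15iii` — the same from `Prop15iii E hC` (applied to the
  member `η̈^Θ` of the theta classes);
* `ThetaSetting.EtaleThetaData.not_prop15iii_of_conj_logUdd_mem_units` — hence **if some `σ₀` of degree `1`
  moves `log(Ü)` by a unit class only (`σ₀·log Ü = log Ü·κ(u₀)`), then `¬ Prop15iii E hC`**: the square identity
  gives `κ(q̈)² ∈ κ(O^×_K̈)`, i.e. (Kummer maps injective) `q_X = q̈² ∈ O^×_K̈`, contradicting `‖q_X‖ < 1`.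

USE (R78): at the stage-1 χ-twisted root model `modelχ` («split-Tate: q Kummer-trivial on the ℤ-direction») the
deck generator fixes `log(Ü)`, so the typed Prop. 1.5 (iii) fails there for EVERY `η` — the kernel form of the
integrator's label «EXPECTED-FALSE AT STAGE 1 BY DESIGN, witnessed at stage 2» (abc-iut-L6-d6); the instantiation
is one line for the model owner (abc-iut-L2-t6) and is NOT made here (no model import). PROOF-ONLY: no `def`,
no instance, no `Prop`-valued definition. HONEST FRAMING: a constraint on the typed interface data; nothing of
[EtTh] is asserted or denied; typed ≠ proved; no side is taken on [IUTchIII] Cor. 3.12.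
-/

noncomputable section

namespace Literature.AnabelianGeometry.EtaleTheta

namespace ThetaSetting

open Literature.AnabelianGeometry.SemiGraphs

variable {p : ℕ} [Fact p.Prime] {D : ThetaSetting p}

/-- `toZ (σ₀·σ₀) = 2` (additively) for `toZ σ₀ = 1`. [cite: MochizukiEtTh2009, §1 p.12] -/
theorem toAdd_toZ_mul_self {σ₀ : D.PiTemp} (hσ₀ : D.toZ σ₀ = Multiplicative.ofAdd 1) :
    Multiplicative.toAdd (D.toZ (σ₀ * σ₀)) = 2 := by
  rw [map_mul, hσ₀, toAdd_mul, toAdd_ofAdd]; rfl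

/-- `‖q̈‖ < 1` (`q̈² = q_X`, `‖q_X‖ < 1`). [cite: MochizukiEtTh2009, §1 p.17] -/
theorem norm_qdd_lt_one : ‖D.qdd‖ < 1 := by
  have h : ‖D.qdd‖ ^ 2 < 1 := by
    rw [← norm_pow, show D.qdd ^ 2 = D.qX from D.sqrtqX_sq]
    exact D.norm_qX_lt_one
  nlinarith [norm_nonneg D.qdd]

/-- `q̈ ∉ O^×_K̈`, and more generally `q̈² · w ≠ v²`… in the form used below: no unit `w` and unit `u₀` with
`q̈² · w = u₀²` in `K̈^×`. [cite: MochizukiEtTh2009, §1 p.17] -/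
theorem qddUnit_sq_mul_ne_sq {w u₀ : (↥D.Kdd)ˣ} (hw : w ∈ D.unitsOKdd) (hu₀ : u₀ ∈ D.unitsOKdd) :
    D.qddUnit ^ 2 * w ≠ u₀ ^ 2 := by
  intro h
  have hw' : ‖((w : D.Kdd) : PadicAlgCl p)‖ = 1 := hw
  have hu' : ‖((u₀ : D.Kdd) : PadicAlgCl p)‖ = 1 := hu₀
  have hq : ((D.qddUnit : D.Kdd) : PadicAlgCl p) = D.qdd := rfl
  have e : ((((D.qddUnit ^ 2 * w : (↥D.Kdd)ˣ)) : D.Kdd) : PadicAlgCl p) =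
      (((u₀ ^ 2 : (↥D.Kdd)ˣ) : D.Kdd) : PadicAlgCl p) := by rw [h]
  simp only [Units.val_mul, Units.val_pow_eq_pow_val] at e
  push_cast at e
  have := congrArg (‖·‖) e
  simp only [norm_mul, norm_pow, hq, hw', hu', mul_one, one_pow] at this
  have hlt := D.norm_qdd_lt_one
  nlinarith [norm_nonneg D.qdd]

namespace KummerData

variable (E : D.KummerData)

/-- **The `Z`-action display at `σ₀` and at `σ₀²` forces `(σ₀·log Ü)² = (log Ü)²·κ(q̈)²·κ(w)`.**
[cite: MochizukiEtTh2009, Prop 1.5 (iii) p.23] -/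
theorem sq_conj_logUdd_of_zLaw (hC : D.Compat) (x' : D.H1Theta (D.GtpYdd.map D.toTheta))
    (hU : haveI := hC.GtpYddTheta_normal
      ∀ σ : D.PiTemp, ∀ u ∈ D.unitsOKdd, ∃ u' ∈ D.unitsOKdd,
        ContH1.conj (MonoidHom.id D.GtpTheta) D.DeltaTheta (D.toTheta σ) (E.kumYdd (E.toKddHat u)) =
          E.kumYdd (E.toKddHat u'))
    (hQ : haveI := hC.GtpYddTheta_normal
      ∀ σ : D.PiTemp, ∃ u ∈ D.unitsOKdd,
        ContH1.conj (MonoidHom.id D.GtpTheta) D.DeltaTheta (D.toTheta σ) (E.kumYdd (E.toKddHat D.qddUnit)) =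
          E.kumYdd (E.toKddHat D.qddUnit) * E.kumYdd (E.toKddHat u))
    {σ₀ : D.PiTemp} (hσ₀ : D.toZ σ₀ = Multiplicative.ofAdd 1)
    (hconj : haveI := hC.GtpYddTheta_normal
      ∀ σ : D.PiTemp, ∃ u ∈ D.unitsOKdd,
        ContH1.conj (MonoidHom.id D.GtpTheta) D.DeltaTheta (D.toTheta σ) x' =
          x' * E.logUdd ^ (-(2 * Multiplicative.toAdd (D.toZ σ)))
             * E.kumYdd (E.toKddHat D.qddUnit) ^
                (-(Multiplicative.toAdd (D.toZ σ) * Multiplicative.toAdd (D.toZ σ)))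
             * E.kumYdd (E.toKddHat u)) :
    haveI := hC.GtpYddTheta_normal
    ∃ w ∈ D.unitsOKdd,
      (ContH1.conj (MonoidHom.id D.GtpTheta) D.DeltaTheta (D.toTheta σ₀) E.logUdd) ^ 2 =
        E.logUdd ^ 2 * E.kumYdd (E.toKddHat D.qddUnit) ^ 2 * E.kumYdd (E.toKddHat w) := by
  haveI := hC.GtpYddTheta_normal
  obtain ⟨u₁, hu₁, h₁⟩ := hconj σ₀
  obtain ⟨u₂, hu₂, h₂⟩ := hconj (σ₀ * σ₀)
  obtain ⟨v, hv, hQv⟩ := hQ σ₀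
  obtain ⟨u₁', hu₁', hu₁σ⟩ := hU σ₀ u₁ hu₁
  rw [hσ₀, toAdd_ofAdd] at h₁
  rw [toAdd_toZ_mul_self hσ₀, conj_toTheta_mul hC, h₁] at h₂
  simp only [map_mul, map_zpow] at h₂
  rw [h₁, hQv, hu₁σ] at h₂
  -- h₂ : x' L^{-2} Q^{-1} κu₁ · (ρL)^{-2} · (Q κv)^{-1} · κu₁' = x' L^{-4} Q^{-4} κu₂  (as zpow expressions)
  refine ⟨u₁ * v⁻¹ * u₁' * u₂⁻¹,
    D.unitsOKdd.mul_mem (D.unitsOKdd.mul_mem (D.unitsOKdd.mul_mem hu₁ (D.unitsOKdd.inv_mem hv)) hu₁')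
      (D.unitsOKdd.inv_mem hu₂), ?_⟩
  simp only [map_mul, map_inv]
  -- solve for `(σ₀·log Ü)²` from `h₂` in the commutative group (transport to `Additive`, then `module`)
  have aux : ∀ {a b c d : Additive (D.H1Theta (D.GtpYdd.map D.toTheta))},
      a = b → c - d = b - a → c = d := fun h e => by
    rw [h, sub_self] at e
    exact sub_eq_zero.mp e
  have h₃ := congrArg Additive.ofMul h₂
  apply Additive.ofMul.injective
  simp only [ofMul_mul, ofMul_zpow, ofMul_pow, ofMul_inv] at h₃ ⊢
  exact aux h₃ (by module)

end KummerData

namespace EtaleThetaData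

variable (E : D.EtaleThetaData)

/-- **Prop. 1.5 (iii) forces `(σ₀·log Ü)² = (log Ü)²·κ(q̈)²·κ(w)`** (apply the typed clause to the member `η̈^Θ`
of the theta classes, at `σ₀` and `σ₀²`). [cite: MochizukiEtTh2009, Prop 1.5 (iii) p.23] -/
theorem sq_conj_logUdd_of_prop15iii (hC : D.Compat)
    (hU : haveI := hC.GtpYddTheta_normal
      ∀ σ : D.PiTemp, ∀ u ∈ D.unitsOKdd, ∃ u' ∈ D.unitsOKdd,
        ContH1.conj (MonoidHom.id D.GtpTheta) D.DeltaTheta (D.toTheta σ) (E.kumYdd (E.toKddHat u)) =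
          E.kumYdd (E.toKddHat u'))
    (hQ : haveI := hC.GtpYddTheta_normal
      ∀ σ : D.PiTemp, ∃ u ∈ D.unitsOKdd,
        ContH1.conj (MonoidHom.id D.GtpTheta) D.DeltaTheta (D.toTheta σ) (E.kumYdd (E.toKddHat D.qddUnit)) =
          E.kumYdd (E.toKddHat D.qddUnit) * E.kumYdd (E.toKddHat u))
    {σ₀ : D.PiTemp} (hσ₀ : D.toZ σ₀ = Multiplicative.ofAdd 1) (h15 : Prop15iii E hC) :
    haveI := hC.GtpYddTheta_normal
    ∃ w ∈ D.unitsOKdd,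
      (ContH1.conj (MonoidHom.id D.GtpTheta) D.DeltaTheta (D.toTheta σ₀) E.logUdd) ^ 2 =
        E.logUdd ^ 2 * E.kumYdd (E.toKddHat D.qddUnit) ^ 2 * E.kumYdd (E.toKddHat w) := by
  have hη : E.etaDd ∈ E.thetaClasses := ⟨1, one_mem _, by rw [one_mul]⟩
  obtain ⟨x', ⟨-, -, hlaw⟩, -⟩ := h15 E.etaDd hη
  exact E.toKummerData.sq_conj_logUdd_of_zLaw hC x' hU hQ hσ₀ hlaw

/-- **No étale-theta datum whose `log(Ü)` is deck-invariant up to units satisfies the typed Prop. 1.5 (iii).**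
If some `σ₀` with `toZ σ₀ = 1` moves `log(Ü)` by a unit class only, then `Prop15iii E hC` fails: the square
identity would put `κ(q̈)²` among the unit classes, i.e. (Kummer maps injective) `q̈²·w = u₀²` in `K̈^×` with
units `w, u₀` — impossible as `‖q̈‖ < 1`. (The kernel form of «the `−a²·log(q̈)` term forces the shear
`Ü ↦ q̈^a·Ü`»; at a split model the clause is expected-false by design.) [cite: MochizukiEtTh2009, Prop 1.5 (iii) p.23] -/
theorem not_prop15iii_of_conj_logUdd_mem_units (hC : D.Compat)
    (hU : haveI := hC.GtpYddTheta_normal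
      ∀ σ : D.PiTemp, ∀ u ∈ D.unitsOKdd, ∃ u' ∈ D.unitsOKdd,
        ContH1.conj (MonoidHom.id D.GtpTheta) D.DeltaTheta (D.toTheta σ) (E.kumYdd (E.toKddHat u)) =
          E.kumYdd (E.toKddHat u'))
    (hQ : haveI := hC.GtpYddTheta_normal
      ∀ σ : D.PiTemp, ∃ u ∈ D.unitsOKdd,
        ContH1.conj (MonoidHom.id D.GtpTheta) D.DeltaTheta (D.toTheta σ) (E.kumYdd (E.toKddHat D.qddUnit)) =
          E.kumYdd (E.toKddHat D.qddUnit) * E.kumYdd (E.toKddHat u))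
    {σ₀ : D.PiTemp} (hσ₀ : D.toZ σ₀ = Multiplicative.ofAdd 1)
    (hfix : haveI := hC.GtpYddTheta_normal
      ∃ u₀ ∈ D.unitsOKdd, ContH1.conj (MonoidHom.id D.GtpTheta) D.DeltaTheta (D.toTheta σ₀) E.logUdd =
        E.logUdd * E.kumYdd (E.toKddHat u₀)) :
    ¬ Prop15iii E hC := by
  intro h15
  obtain ⟨w, hw, hsq⟩ := E.sq_conj_logUdd_of_prop15iii hC hU hQ hσ₀ h15
  obtain ⟨u₀, hu₀, hfix⟩ := hfix
  rw [hfix, mul_pow, mul_assoc] at hsq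
  have hsq' : E.kumYdd (E.toKddHat u₀) ^ 2 = E.kumYdd (E.toKddHat D.qddUnit) ^ 2 * E.kumYdd (E.toKddHat w) :=
    mul_left_cancel hsq
  rw [← map_pow, ← map_pow, ← map_pow, ← map_pow, ← map_mul, ← map_mul] at hsq'
  have heq : u₀ ^ 2 = D.qddUnit ^ 2 * w := E.toKddHat_injective (E.kumYdd_injective hsq')
  exact D.qddUnit_sq_mul_ne_sq hw hu₀ heq.symm

end EtaleThetaData

end ThetaSetting

end Literature.AnabelianGeometry.EtaleTheta

end
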